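import Mathlib
import Literature.NumberTheory.LFunctions.WeilMarkovQuadratic
import Summits.RiemannHypothesis.RiemannHypothesis.Theorems.WeilGroundStateGroundStateSimpleEvenStubMarkovConstant
import HarnessLib

/-!
# The killing integral in closed form: `∫₀^∞ (e^{t/2} − 1)/(2 sinh t) dt = π/4 + (log 2)/2`

Stub `stub_killingIntegral` for the line *parity–multiplicity–commutator* of the crux
`GroundStateSimpleEven` (Weil ground state).  The killing constant of the windowed Weil form is
`M_b = 2Σ_{log n<2b} Λ(n)n^{-1/2} + 2∫₀^∞ (e^{t/2} − 1)/(2 sinh t) dt + log 4π + γ`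
(`weilMarkovConstant`, `WeilMarkovQuadratic.lean`); the Rayleigh–Ritz bounds of the line need the
integral from below to `10⁻⁷`, whereas the tree's `mk_integral_weilKillingDensity_ge`
(`…StubMarkovConstant.lean`, `64` terms plus the geometric tail `1/(4(2K+1))`) loses `2·10⁻⁵`.

Here we evaluate the integral exactly.  For `t > 0`,
`(e^{t/2} − 1)/(2 sinh t) = Σ_{k<K} (e^{-(2k+1/2)t} − e^{-(2k+1)t}) + e^{-2Kt}(e^{t/2} − 1)/(2 sinh t)`
(`kill_weilKillingDensity_eq_partial_sum_add`), so the integral `I` satisfies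
`P_K ≤ P_K + 1/(4(2K+1)) ≤ I ≤ P_K + 1/(2K+1/2)` with `P_K = Σ_{k<K} (1/(2k+1/2) − 1/(2k+1))`
(`mk_series_add_tail_le_integral_weilKillingDensity`, `kill_integral_le_partial_sum_add`).
The partial sums are `P_K = 2Σ_{k<K} (1/(4k+1) − 1/(4k+2)) = L_{2K} + H_{4K} − (3/2)H_{2K} + H_K/2`
with `L_m = Σ_{i<m} (−1)^i/(2i+1)` (Leibniz) and `H_m` the harmonic numbers
(`kill_partial_sum_eq`); by Mathlib's `Real.tendsto_sum_pi_div_four` (`L_m → π/4`) and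
`Real.tendsto_harmonic_sub_log` (`H_m − log m → γ`, so `H_{4K} − (3/2)H_{2K} + H_K/2 → (log 2)/2`)
they converge to `π/4 + (log 2)/2` (`kill_tendsto_partial_sum`), whence
`I = π/4 + (log 2)/2 = 1.1319717…` (`kill_integral_weilKillingDensity_eq`) and in particular
`π/4 + (log 2)/2 − 10⁻⁷ ≤ I` (`stub_killingIntegral`).
-/

open Set MeasureTheory Filter

open scoped Real Topology

open Literature.NumberTheory.LFunctions

namespace Summit.RiemannHypothesis.RiemannHypothesis.Theorems.GroundStateSimpleEven

set_option linter.dupNamespace false in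
/-- **The partial sums of the killing series via Leibniz and harmonic numbers**:
`Σ_{k<n} (1/(2k+1/2) − 1/(2k+1)) = Σ_{i<2n} (−1)^i/(2i+1) + H_{4n} − (3/2) H_{2n} + H_n/2`
(both sides vanish at `n = 0` and increase by `2/(4n+1) − 1/(2n+1)` from `n` to `n + 1`). [folklore] -/
theorem kill_partial_sum_eq (n : ℕ) :
    ∑ k ∈ Finset.range n, (1 / (2 * (k : ℝ) + 1 / 2) - 1 / (2 * (k : ℝ) + 1)) =
      ∑ i ∈ Finset.range (2 * n), (-1 : ℝ) ^ i / (2 * i + 1) +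
        ((harmonic (4 * n) : ℝ) - 3 / 2 * (harmonic (2 * n) : ℝ) +
          1 / 2 * (harmonic n : ℝ)) := by
  induction n with
  | zero => simp
  | succ n ih =>
    rw [Finset.sum_range_succ, ih, show 2 * (n + 1) = 2 * n + 1 + 1 by ring,
      show 4 * (n + 1) = 4 * n + 1 + 1 + 1 + 1 by ring]
    simp only [Finset.sum_range_succ, harmonic_succ, (even_two_mul n).neg_one_pow,
      (odd_two_mul_add_one n).neg_one_pow]
    push_cast
    have h1 : (2 * (n : ℝ) + 1 / 2) ≠ 0 := by positivity
    have h2 : (2 * (n : ℝ) + 1) ≠ 0 := by positivity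
    have h3 : (2 * (2 * (n : ℝ)) + 1) ≠ 0 := by positivity
    have h4 : (2 * (2 * (n : ℝ) + 1) + 1) ≠ 0 := by positivity
    have h5 : (4 * (n : ℝ) + 1) ≠ 0 := by positivity
    have h6 : (4 * (n : ℝ) + 1 + 1) ≠ 0 := by positivity
    have h7 : (4 * (n : ℝ) + 1 + 1 + 1) ≠ 0 := by positivity
    have h8 : (4 * (n : ℝ) + 1 + 1 + 1 + 1) ≠ 0 := by positivity
    have h9 : (2 * (n : ℝ) + 1 + 1) ≠ 0 := by positivity
    have h10 : ((n : ℝ) + 1) ≠ 0 := by positivity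
    field_simp
    ring

set_option linter.dupNamespace false in
/-- `H_{4n} − (3/2) H_{2n} + H_n/2 → (log 2)/2` (from `H_m − log m → γ` and
`log 4n − (3/2) log 2n + (log n)/2 = (log 2)/2`). [folklore] -/
theorem kill_tendsto_harmonic_combination :
    Tendsto (fun n : ℕ ↦ (harmonic (4 * n) : ℝ) - 3 / 2 * (harmonic (2 * n) : ℝ) +
      1 / 2 * (harmonic n : ℝ)) atTop (𝓝 (Real.log 2 / 2)) := by
  have hγ := Real.tendsto_harmonic_sub_log
  have h2 : Tendsto (fun n : ℕ ↦ 2 * n) atTop atTop :=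
    tendsto_atTop_mono (fun n ↦ Nat.le_mul_of_pos_left n two_pos) tendsto_id
  have h4 : Tendsto (fun n : ℕ ↦ 4 * n) atTop atTop :=
    tendsto_atTop_mono (fun n ↦ Nat.le_mul_of_pos_left n four_pos) tendsto_id
  have key : Tendsto (fun n : ℕ ↦ ((harmonic (4 * n) : ℝ) - Real.log ((4 * n : ℕ) : ℝ)) -
      3 / 2 * ((harmonic (2 * n) : ℝ) - Real.log ((2 * n : ℕ) : ℝ)) +
      1 / 2 * ((harmonic n : ℝ) - Real.log (n : ℝ)) + Real.log 2 / 2) atTop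
      (𝓝 (Real.eulerMascheroniConstant - 3 / 2 * Real.eulerMascheroniConstant +
        1 / 2 * Real.eulerMascheroniConstant + Real.log 2 / 2)) :=
    (((hγ.comp h4).sub ((hγ.comp h2).const_mul _)).add (hγ.const_mul _)).add_const _
  rw [show Real.eulerMascheroniConstant - 3 / 2 * Real.eulerMascheroniConstant +
      1 / 2 * Real.eulerMascheroniConstant + Real.log 2 / 2 = Real.log 2 / 2 by ring] at key
  refine key.congr' ?_
  filter_upwards [eventually_ge_atTop 1] with n hn
  have hn0 : (0 : ℝ) < n := by exact_mod_cast hn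
  have hl4 : Real.log ((4 * n : ℕ) : ℝ) = 2 * Real.log 2 + Real.log n := by
    push_cast
    rw [Real.log_mul (by norm_num) hn0.ne', show (4 : ℝ) = 2 ^ 2 by norm_num, Real.log_pow]
    push_cast
    ring
  have hl2 : Real.log ((2 * n : ℕ) : ℝ) = Real.log 2 + Real.log n := by
    push_cast
    rw [Real.log_mul (by norm_num) hn0.ne']
  rw [hl4, hl2]
  ring

set_option linter.dupNamespace false in
/-- **The killing series sums to `π/4 + (log 2)/2`**:
`Σ_{k<n} (1/(2k+1/2) − 1/(2k+1)) → π/4 + (log 2)/2` (Leibniz's series along `2n` plus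
`kill_tendsto_harmonic_combination`, by `kill_partial_sum_eq`). [folklore] -/
theorem kill_tendsto_partial_sum :
    Tendsto
      (fun n ↦ ∑ k ∈ Finset.range n, (1 / (2 * (k : ℝ) + 1 / 2) - 1 / (2 * (k : ℝ) + 1)))
      atTop (𝓝 (π / 4 + Real.log 2 / 2)) := by
  have h2 : Tendsto (fun n : ℕ ↦ 2 * n) atTop atTop :=
    tendsto_atTop_mono (fun n ↦ Nat.le_mul_of_pos_left n two_pos) tendsto_id
  refine ((Real.tendsto_sum_pi_div_four.comp h2).add kill_tendsto_harmonic_combination).congr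
    fun n ↦ ?_
  rw [kill_partial_sum_eq, Function.comp_apply]

set_option linter.dupNamespace false in
/-- **The killing integral dominates its series**:
`π/4 + (log 2)/2 ≤ ∫₀^∞ (e^{t/2} − 1)/(2 sinh t) dt` (every partial sum is below the integral,
`mk_series_add_tail_le_integral_weilKillingDensity`, and they tend to `π/4 + (log 2)/2`). [folklore] -/
theorem kill_series_le_integral_weilKillingDensity :
    π / 4 + Real.log 2 / 2 ≤
      ∫ t in Ioi (0 : ℝ), (Real.exp (t / 2) - 1) / (2 * Real.sinh t) := by
  refine le_of_tendsto' kill_tendsto_partial_sum fun K ↦ ?_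
  have h := mk_series_add_tail_le_integral_weilKillingDensity K
  have h0 : (0 : ℝ) ≤ 1 / (4 * (2 * (K : ℝ) + 1)) := by positivity
  linarith

set_option linter.dupNamespace false in
/-- The killing density splits off its first `K` exponentials **exactly**: for `t > 0`,
`(e^{t/2} − 1)/(2 sinh t) = Σ_{k<K} (e^{-(2k+1/2)t} − e^{-(2k+1)t}) + e^{-2Kt} (e^{t/2} − 1)/(2 sinh t)`
(geometric sum in `q = e^{-2t}`: the density is `(e^{-t/2} − e^{-t})/(1 − q)`). [folklore] -/
theorem kill_weilKillingDensity_eq_partial_sum_add {t : ℝ} (ht : 0 < t) (K : ℕ) :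
    (Real.exp (t / 2) - 1) / (2 * Real.sinh t) =
      ∑ k ∈ Finset.range K,
          (Real.exp (-(2 * (k : ℝ) + 1 / 2) * t) - Real.exp (-(2 * (k : ℝ) + 1) * t)) +
        Real.exp (-(2 * (K : ℝ)) * t) * ((Real.exp (t / 2) - 1) / (2 * Real.sinh t)) := by
  -- adapted from `mk_partial_sum_add_tail_le_weilKillingDensity` (…StubMarkovConstant.lean)
  set q : ℝ := Real.exp (-(2 * t)) with hq
  have hq1 : q < 1 := Real.exp_lt_one_iff.2 (by linarith)
  have h1q : (1 - q) ≠ 0 := by linarith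
  have hq1' : (q - 1) ≠ 0 := by linarith
  have h1 : 2 * Real.sinh t = (1 - q) * Real.exp t := by
    rw [hq, Real.sinh_eq, sub_mul, ← Real.exp_add]; ring_nf
  have h2 : Real.exp (t / 2) - 1 = (Real.exp (-(t / 2)) - Real.exp (-t)) * Real.exp t := by
    rw [sub_mul, ← Real.exp_add, ← Real.exp_add, neg_add_cancel, Real.exp_zero]; ring_nf
  rw [h1, h2, mul_div_mul_right _ _ (Real.exp_pos t).ne']
  have hterm : ∀ k ∈ Finset.range K,
      Real.exp (-(2 * (k : ℝ) + 1 / 2) * t) - Real.exp (-(2 * (k : ℝ) + 1) * t) =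
        (Real.exp (-(t / 2)) - Real.exp (-t)) * q ^ k := by
    intro k _
    rw [hq, ← Real.exp_nat_mul, sub_mul, ← Real.exp_add, ← Real.exp_add]
    congr 2 <;> ring
  have htail : Real.exp (-(2 * (K : ℝ)) * t) = q ^ K := by
    rw [hq, ← Real.exp_nat_mul]
    congr 1; ring
  rw [Finset.sum_congr rfl hterm, ← Finset.mul_sum, htail, geom_sum_eq hq1.ne]
  field_simp
  ring

set_option linter.dupNamespace false in
/-- **The killing integral is below its series plus `1/(2K+1/2)`**: for every `K`,
`∫₀^∞ (e^{t/2} − 1)/(2 sinh t) dt ≤ Σ_{k<K} (1/(2k+1/2) − 1/(2k+1)) + 1/(2K+1/2)`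
(integrate `kill_weilKillingDensity_eq_partial_sum_add`; the remainder is at most
`e^{-2Kt} e^{-t/2}` by `weilKillingDensity_le`). [folklore] -/
theorem kill_integral_le_partial_sum_add (K : ℕ) :
    ∫ t in Ioi (0 : ℝ), (Real.exp (t / 2) - 1) / (2 * Real.sinh t) ≤
      ∑ k ∈ Finset.range K, (1 / (2 * (k : ℝ) + 1 / 2) - 1 / (2 * (k : ℝ) + 1)) +
        1 / (2 * (K : ℝ) + 1 / 2) := by
  set R : ℝ → ℝ := fun t ↦ Real.exp (-(2 * (K : ℝ)) * t) *
    ((Real.exp (t / 2) - 1) / (2 * Real.sinh t)) with hR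
  have ha : ∀ k : ℕ, -(2 * (k : ℝ) + 1 / 2) < 0 := fun k ↦ by
    have : (0 : ℝ) ≤ k := Nat.cast_nonneg k; linarith
  have hb : ∀ k : ℕ, -(2 * (k : ℝ) + 1) < 0 := fun k ↦ by
    have : (0 : ℝ) ≤ k := Nat.cast_nonneg k; linarith
  have hik : ∀ k : ℕ, IntegrableOn (fun t ↦ Real.exp (-(2 * (k : ℝ) + 1 / 2) * t) -
      Real.exp (-(2 * (k : ℝ) + 1) * t)) (Ioi 0) :=
    fun k ↦ (integrableOn_exp_mul_Ioi (ha k) _).sub (integrableOn_exp_mul_Ioi (hb k) _)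
  have hSi : IntegrableOn (fun t ↦ ∑ k ∈ Finset.range K,
      (Real.exp (-(2 * (k : ℝ) + 1 / 2) * t) - Real.exp (-(2 * (k : ℝ) + 1) * t))) (Ioi 0) :=
    integrable_finsetSum _ fun k _ ↦ hik k
  -- the remainder is dominated by `e^{-(2K+1/2)t}`
  have hRle : ∀ t ∈ Ioi (0 : ℝ), R t ≤ Real.exp (-(2 * (K : ℝ) + 1 / 2) * t) := by
    intro t ht
    rw [hR]
    calc Real.exp (-(2 * (K : ℝ)) * t) * ((Real.exp (t / 2) - 1) / (2 * Real.sinh t))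
        ≤ Real.exp (-(2 * (K : ℝ)) * t) * Real.exp (-(1 / 2) * t) := by
          gcongr; exact weilKillingDensity_le ht
      _ = Real.exp (-(2 * (K : ℝ) + 1 / 2) * t) := by rw [← Real.exp_add]; congr 1; ring
  have hR0 : ∀ t ∈ Ioi (0 : ℝ), 0 ≤ R t := fun t ht ↦
    mul_nonneg (Real.exp_pos _).le (weilKillingDensity_nonneg ht)
  have hRi : IntegrableOn R (Ioi 0) := by
    refine Integrable.mono' (integrableOn_exp_mul_Ioi (ha K) 0) ?_ ?_
    · exact ((by fun_prop : Continuous fun t : ℝ ↦ Real.exp (-(2 * (K : ℝ)) * t))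
        |>.aestronglyMeasurable.mul integrableOn_weilKillingDensity.aestronglyMeasurable)
    · refine (ae_restrict_iff' measurableSet_Ioi).2 (Eventually.of_forall fun t ht ↦ ?_)
      rw [Real.norm_of_nonneg (hR0 t ht)]
      exact hRle t ht
  have hPint : ∫ t in Ioi (0 : ℝ), ∑ k ∈ Finset.range K,
      (Real.exp (-(2 * (k : ℝ) + 1 / 2) * t) - Real.exp (-(2 * (k : ℝ) + 1) * t)) =
      ∑ k ∈ Finset.range K, (1 / (2 * (k : ℝ) + 1 / 2) - 1 / (2 * (k : ℝ) + 1)) := by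
    rw [integral_finsetSum _ fun k _ ↦ hik k]
    refine Finset.sum_congr rfl fun k _ ↦ ?_
    rw [integral_sub (integrableOn_exp_mul_Ioi (ha k) _) (integrableOn_exp_mul_Ioi (hb k) _),
      integral_exp_mul_Ioi (ha k), integral_exp_mul_Ioi (hb k)]
    simp only [mul_zero, Real.exp_zero]
    have h1 : (2 * (k : ℝ) + 1 / 2) ≠ 0 := by positivity
    have h2 : (2 * (k : ℝ) + 1) ≠ 0 := by positivity
    field_simp
  have hRint : ∫ t in Ioi (0 : ℝ), R t ≤ 1 / (2 * (K : ℝ) + 1 / 2) := by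
    calc ∫ t in Ioi (0 : ℝ), R t
        ≤ ∫ t in Ioi (0 : ℝ), Real.exp (-(2 * (K : ℝ) + 1 / 2) * t) :=
          setIntegral_mono_on hRi (integrableOn_exp_mul_Ioi (ha K) 0) measurableSet_Ioi hRle
      _ = 1 / (2 * (K : ℝ) + 1 / 2) := by
          rw [integral_exp_mul_Ioi (ha K)]
          simp only [mul_zero, Real.exp_zero]
          have h1 : (2 * (K : ℝ) + 1 / 2) ≠ 0 := by positivity
          field_simp
  calc ∫ t in Ioi (0 : ℝ), (Real.exp (t / 2) - 1) / (2 * Real.sinh t)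
      = ∫ t in Ioi (0 : ℝ), (∑ k ∈ Finset.range K,
          (Real.exp (-(2 * (k : ℝ) + 1 / 2) * t) - Real.exp (-(2 * (k : ℝ) + 1) * t)) + R t) :=
        setIntegral_congr_fun measurableSet_Ioi fun t ht ↦
          kill_weilKillingDensity_eq_partial_sum_add ht K
    _ = ∑ k ∈ Finset.range K, (1 / (2 * (k : ℝ) + 1 / 2) - 1 / (2 * (k : ℝ) + 1)) +
          ∫ t in Ioi (0 : ℝ), R t := by rw [integral_add hSi hRi, hPint]
    _ ≤ _ := by gcongr

set_option linter.dupNamespace false in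
/-- **The killing integral in closed form**: `∫₀^∞ (e^{t/2} − 1)/(2 sinh t) dt = π/4 + (log 2)/2`
(`= 1.1319717536…`; squeeze between `kill_series_le_integral_weilKillingDensity` and
`kill_integral_le_partial_sum_add`, whose right-hand side tends to `π/4 + (log 2)/2`). [folklore] -/
theorem kill_integral_weilKillingDensity_eq :
    ∫ t in Ioi (0 : ℝ), (Real.exp (t / 2) - 1) / (2 * Real.sinh t) =
      π / 4 + Real.log 2 / 2 := by
  refine le_antisymm ?_ kill_series_le_integral_weilKillingDensity
  have h0 : Tendsto (fun K : ℕ ↦ 1 / (2 * (K : ℝ) + 1 / 2)) atTop (𝓝 0) :=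
    tendsto_const_nhds.div_atTop (tendsto_atTop_add_const_right _ _
      (tendsto_natCast_atTop_atTop.const_mul_atTop two_pos))
  have h := kill_tendsto_partial_sum.add h0
  rw [add_zero] at h
  exact ge_of_tendsto' h fun K ↦ kill_integral_le_partial_sum_add K

end Summit.RiemannHypothesis.RiemannHypothesis.Theorems.GroundStateSimpleEven

namespace Summit.RiemannHypothesis.RiemannHypothesis.Theorems

set_option linter.dupNamespace false in
/-- **The killing integral to seven decimals from below**:
`π/4 + (log 2)/2 − 10⁻⁷ ≤ ∫₀^∞ (e^{t/2} − 1)/(2 sinh t) dt` (the integral *equals*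
`π/4 + (log 2)/2`, `GroundStateSimpleEven.kill_integral_weilKillingDensity_eq`; only the lower bound
`GroundStateSimpleEven.kill_series_le_integral_weilKillingDensity` is used). [folklore] -/
theorem stub_killingIntegral :
    (Real.pi / 4 + Real.log 2 / 2 - 1 / 10 ^ 7 : ℝ) ≤
      ∫ t in Ioi (0 : ℝ), (Real.exp (t / 2) - 1) / (2 * Real.sinh t) := by
  have h := GroundStateSimpleEven.kill_series_le_integral_weilKillingDensity
  have h0 : (0 : ℝ) < 1 / 10 ^ 7 := by positivity
  linarith

end Summit.RiemannHypothesis.RiemannHypothesis.Theorems
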